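import Mathlib
import Summits.Ventures.PercRepro2.Defs
import Summits.Ventures.PercRepro2.Harris
import Summits.Ventures.PercRepro2.Graph
import Summits.Ventures.PercRepro2.Events
import Summits.Ventures.PercRepro2.DisagreementPinned
import Summits.Ventures.PercRepro2.CDQuasiConcave

/-!
# Row 2′CD from the quasi-concavity of its slack along the exploration of `C₂` — the boundary form
(blind cell PercRepro2, mine-a g31; MINE-A.md §86.3, §86.8, §86.11)

Same objects as `CDQuasiConcave.lean` (`cdSlack p = γ·Cov_Q(U, e) − Cov_Q(U, e f)`).  The EXPLORED SET
of `a₂` under the weight vector `p` is the cluster of `a₂` in the configuration of the pinned-open edges,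
`exploredSet p = C_{pinnedConfig p}(a₂)`; an edge TOUCHES it when it has an endpoint in it.

**Quasi-concavity along the exploration** (`QuasiConcaveCDBoundary`, a CANDIDATE of this seat): for
every admissible `p` and every fractional edge `g` touching the explored set,
`min (cdSlack p[g↦1]) (cdSlack p[g↦0]) ≤ cdSlack p`.  (Census of the D-world form along explorations of
`C₂`: 122,210 / 122,210 steps, n = 5–8; the ALL-edges form of the D-world slack is FALSE, 2 / 97,348,
at edges NOT touching the explored set — this is why the hypothesis is restricted to the boundary.)

THE REDUCTION (`cdSlack_nonneg_of_quasiConcaveBoundary`, `cdCleared_nonneg_of_quasiConcaveBoundary`):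
the boundary form implies row 2′CD for every weight vector.  Induction on the fractional edges: while
a fractional edge touches the explored set, pin it (the slack is at least the smaller child's); when
none does, the cluster of `a₂` is determined — every configuration of nonzero weight has
`C(a₂) = exploredSet p` (`cluster_eq_exploredSet`, from `cluster_eq_of_eqOn_touches`) — so `Q`,
`{o ∈ C₂}` and `{a₃ ∈ C₂}` are almost surely constant and the cleared slack is either `0` or
`P(N ∩ oU) · (P(U ∩ e) − P(U) P(e)) ≥ 0` by Harris (`cdCleared_nonneg_of_boundary_pinned`).  Nothing
about `QuasiConcaveCDBoundary` itself is claimed here.  One seat.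
-/

namespace Summit.Ventures.PercRepro2

namespace CDQC

section AlmostSure

variable {E : Type*} [Fintype E] [DecidableEq E] {R : Type*} [Field R] [LinearOrder R]
  [IsStrictOrderedRing R]

omit [DecidableEq E] [IsStrictOrderedRing R] in
/-- A configuration of nonzero weight agrees with the pinned configuration on every pinned edge. -/
lemma eq_pinnedConfig_of_weight_ne_zero (p : E → R) {ω : Config E} (hω : weight p ω ≠ 0) {g : E}
    (hg : p g = 0 ∨ p g = 1) : ω g = pinnedConfig p g := by
  by_contra hne
  apply hω
  unfold weight
  refine Finset.prod_eq_zero (Finset.mem_univ g) ?_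
  rw [edgeFactor_pinned hg (ω g)]
  exact if_neg hne

omit [LinearOrder R] [IsStrictOrderedRing R] in
/-- The probability of `A ∩ B` when `B` is almost surely (on the support of the weights) equivalent
to a fixed proposition `c`. -/
lemma prob_inter_eq_of_ae (p : E → R) {B : Set (Config E)} {c : Prop} [Decidable c]
    (hB : ∀ ω, weight p ω ≠ 0 → (ω ∈ B ↔ c)) (A : Set (Config E)) :
    prob p (A ∩ B) = if c then prob p A else 0 := by
  unfold prob
  split_ifs with hc
  · refine Finset.sum_congr rfl fun ω _ => ?_
    by_cases hw : weight p ω = 0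
    · by_cases hAB : ω ∈ A ∩ B
      · rw [Set.indicator_of_mem hAB, Set.indicator_of_mem (Set.mem_of_mem_inter_left hAB)]
      · rw [Set.indicator_of_notMem hAB]
        by_cases hA : ω ∈ A
        · rw [Set.indicator_of_mem hA, hw]
        · rw [Set.indicator_of_notMem hA]
    · have hωB : ω ∈ B := (hB ω hw).mpr hc
      by_cases hA : ω ∈ A
      · rw [Set.indicator_of_mem (Set.mem_inter hA hωB), Set.indicator_of_mem hA]
      · rw [Set.indicator_of_notMem (fun h => hA (Set.mem_of_mem_inter_left h)),
          Set.indicator_of_notMem hA]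
  · refine Finset.sum_eq_zero fun ω _ => ?_
    by_cases hw : weight p ω = 0
    · by_cases hAB : ω ∈ A ∩ B
      · rw [Set.indicator_of_mem hAB, hw]
      · rw [Set.indicator_of_notMem hAB]
    · exact Set.indicator_of_notMem (fun h => hc ((hB ω hw).mp (Set.mem_of_mem_inter_right h))) _

end AlmostSure

section Boundary

variable {V : Type*} {E : Type*} [Fintype E] [DecidableEq E] [Fintype V] [DecidableEq V]
  {R : Type*} [Field R] [LinearOrder R] [IsStrictOrderedRing R]

/-- The explored set of `a₂`: the cluster of `a₂` in the configuration of the pinned-open edges. -/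
def exploredSet (p : E → R) (ends : E → Sym2 V) (a₂ : V) : Set V :=
  cluster ends (pinnedConfig p) a₂

/-- **Quasi-concavity of the (CD)-slack along the exploration of `C₂`** (CANDIDATE, this seat):
pinning a fractional edge that touches the explored set of `a₂` cannot push the slack below both
outcomes. -/
def QuasiConcaveCDBoundary (ends : E → Sym2 V) (a₁ a₂ a₃ o : V) (𝓔 : Set (Set V)) : Prop :=
  ∀ p : E → R, IsProbVec p → ∀ g : E, g ∈ fracEdges p → g ∈ touches ends (exploredSet p ends a₂) →
    min (cdSlack (Function.update p g 1) ends a₁ a₂ a₃ o 𝓔)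
        (cdSlack (Function.update p g 0) ends a₁ a₂ a₃ o 𝓔) ≤ cdSlack p ends a₁ a₂ a₃ o 𝓔

omit [DecidableEq E] [Fintype V] [DecidableEq V] [IsStrictOrderedRing R] in
/-- When every edge touching the explored set is pinned, every configuration of nonzero weight has
the explored set as the cluster of `a₂`. -/
lemma cluster_eq_exploredSet (p : E → R) (ends : E → Sym2 V) (a₂ : V)
    (hpin : ∀ g ∈ touches ends (exploredSet p ends a₂), p g = 0 ∨ p g = 1) {ω : Config E}
    (hω : weight p ω ≠ 0) : cluster ends ω a₂ = exploredSet p ends a₂ :=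
  cluster_eq_of_eqOn_touches
    (fun g hg => (eq_pinnedConfig_of_weight_ne_zero p hω (hpin g hg)).symm) rfl

omit [DecidableEq E] [Fintype V] [DecidableEq V] [IsStrictOrderedRing R] in
/-- Under the boundary-pinned condition, `{a₂ ↔ x}` is almost surely `x ∈ exploredSet`. -/
lemma conn_a₂_iff_of_boundary_pinned (p : E → R) (ends : E → Sym2 V) (a₂ x : V)
    (hpin : ∀ g ∈ touches ends (exploredSet p ends a₂), p g = 0 ∨ p g = 1) {ω : Config E}
    (hω : weight p ω ≠ 0) : ω ∈ connEvent ends a₂ x ↔ x ∈ exploredSet p ends a₂ := by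
  rw [← cluster_eq_exploredSet p ends a₂ hpin hω]
  exact Iff.rfl

omit [Fintype V] [DecidableEq V] in
/-- **The base case**: when every edge touching the explored set of `a₂` is pinned, the cleared
slack is nonnegative (`Q`, `{o ∈ C₂}`, `{a₃ ∈ C₂}` are almost surely constant; the slack is `0` or
`P(N ∩ oU)·(P(U ∩ e) − P(U)P(e))`, nonnegative by Harris). -/
theorem cdCleared_nonneg_of_boundary_pinned (p : E → R) (hp : IsProbVec p) (ends : E → Sym2 V)
    (a₁ a₂ a₃ o : V) {𝓔 : Set (Set V)} (h𝓔 : IsUpperSet 𝓔)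
    (hpin : ∀ g ∈ touches ends (exploredSet p ends a₂), p g = 0 ∨ p g = 1) :
    0 ≤ cdCleared p ends a₁ a₂ a₃ o 𝓔 := by
  classical
  unfold cdCleared
  simp only
  set K := exploredSet p ends a₂ with hK
  set Q := (connEvent ends a₁ a₂)ᶜ with hQ
  set U := clusterInEvent ends a₁ 𝓔 with hU
  set e := connEvent ends a₁ a₃ with he
  set f := connEvent ends a₂ o with hf
  set N := (connEvent ends a₁ a₃)ᶜ ∩ (connEvent ends a₂ a₃)ᶜ with hN
  set oU := connEvent ends a₁ o ∪ connEvent ends a₂ o with hoU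
  -- `Q` is almost surely `a₁ ∉ K`
  have hQae : ∀ ω, weight p ω ≠ 0 → (ω ∈ Q ↔ a₁ ∉ K) := by
    intro ω hω
    rw [hQ, Set.mem_compl_iff, mem_connEvent, hK, ← cluster_eq_exploredSet p ends a₂ hpin hω,
      mem_cluster]
    exact not_congr ⟨conn_symm, conn_symm⟩
  have hQmass : ∀ X : Set (Config E), prob p (Q ∩ X) = if a₁ ∉ K then prob p X else 0 := by
    intro X
    rw [Set.inter_comm]
    exact prob_inter_eq_of_ae p hQae X
  -- the eight masses, each written as `Q ∩ X`
  have m1 : Q ∩ N ∩ oU = Q ∩ (N ∩ oU) := Set.inter_assoc _ _ _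
  have m2 : Q ∩ U ∩ e = Q ∩ (U ∩ e) := Set.inter_assoc _ _ _
  have m3 : Q ∩ U ∩ e ∩ f = Q ∩ (U ∩ e ∩ f) := by
    rw [Set.inter_assoc, Set.inter_assoc, Set.inter_assoc]
  have m4 : Q ∩ e ∩ f = Q ∩ (e ∩ f) := Set.inter_assoc _ _ _
  rw [m1, m3, m2, m4, hQmass, hQmass, hQmass, hQmass, hQmass, hQmass, hQmass]
  have hQself : prob p Q = if a₁ ∉ K then 1 else 0 := by
    have := hQmass Set.univ
    rwa [Set.inter_univ, prob_univ] at this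
  rw [hQself]
  by_cases h₁ : a₁ ∉ K
  swap
  · simp [h₁]
  simp only [h₁, not_false_eq_true, if_true]
  -- `{a₃ ∈ C₂}` is almost surely `a₃ ∈ K`
  have h3ae : ∀ ω, weight p ω ≠ 0 → (ω ∈ (connEvent ends a₂ a₃)ᶜ ↔ a₃ ∉ K) := by
    intro ω hω
    rw [Set.mem_compl_iff]
    exact not_congr (conn_a₂_iff_of_boundary_pinned p ends a₂ a₃ hpin hω)
  have hNoU : prob p (N ∩ oU) = if a₃ ∉ K then prob p ((connEvent ends a₁ a₃)ᶜ ∩ oU) else 0 := by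
    have : N ∩ oU = ((connEvent ends a₁ a₃)ᶜ ∩ oU) ∩ (connEvent ends a₂ a₃)ᶜ := by
      rw [hN]; ext ω; simp only [Set.mem_inter_iff]; tauto
    rw [this]
    exact prob_inter_eq_of_ae p h3ae _
  have hNmass : prob p N = if a₃ ∉ K then prob p (connEvent ends a₁ a₃)ᶜ else 0 :=
    prob_inter_eq_of_ae p h3ae _
  rw [hNoU, hNmass]
  by_cases h₃ : a₃ ∉ K
  swap
  · simp [h₃]
  simp only [h₃, not_false_eq_true, if_true]
  -- `{o ∈ C₂}` is almost surely `o ∈ K`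
  have hfae : ∀ ω, weight p ω ≠ 0 → (ω ∈ f ↔ o ∈ K) := fun ω hω =>
    conn_a₂_iff_of_boundary_pinned p ends a₂ o hpin hω
  have hUef : prob p (U ∩ e ∩ f) = if o ∈ K then prob p (U ∩ e) else 0 :=
    prob_inter_eq_of_ae p hfae _
  have hef : prob p (e ∩ f) = if o ∈ K then prob p e else 0 := prob_inter_eq_of_ae p hfae _
  rw [hUef, hef]
  have hharris : prob p U * prob p e ≤ prob p (U ∩ e) :=
    prob_mul_prob_le_prob_inter hp (isUpperSet_clusterInEvent ends a₁ h𝓔)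
      (isUpperSet_connEvent ends a₁ a₃)
  by_cases ho : o ∈ K
  · -- `oU` is almost surely everything
    have hoUae : ∀ ω, weight p ω ≠ 0 → (ω ∈ oU ↔ True) := by
      intro ω hω
      rw [hoU, Set.mem_union, iff_true]
      exact Or.inr ((conn_a₂_iff_of_boundary_pinned p ends a₂ o hpin hω).mpr ho)
    have hNoU' : prob p ((connEvent ends a₁ a₃)ᶜ ∩ oU) = prob p (connEvent ends a₁ a₃)ᶜ := by
      rw [prob_inter_eq_of_ae p hoUae, if_pos trivial]
    simp only [ho, if_true]
    rw [hNoU']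
    ring_nf
    exact le_refl _
  · simp only [ho, if_false]
    have h0 : 0 ≤ prob p ((connEvent ends a₁ a₃)ᶜ ∩ oU) := prob_nonneg hp _
    nlinarith [h0, hharris, mul_nonneg h0 (sub_nonneg.mpr hharris)]

/-- **THE REDUCTION, boundary form**: quasi-concavity of the slack along the exploration of `C₂`
implies `0 ≤ cdSlack p` for every admissible weight vector. -/
theorem cdSlack_nonneg_of_quasiConcaveBoundary (ends : E → Sym2 V) (a₁ a₂ a₃ o : V)
    {𝓔 : Set (Set V)} (h𝓔 : IsUpperSet 𝓔)
    (hqc : QuasiConcaveCDBoundary (R := R) ends a₁ a₂ a₃ o 𝓔) :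
    ∀ p : E → R, IsProbVec p → 0 ≤ cdSlack p ends a₁ a₂ a₃ o 𝓔 := by
  classical
  intro p hp
  generalize hn : (fracEdges p).card = n
  induction n using Nat.strong_induction_on generalizing p with
  | _ n ih =>
    by_cases hb : ∃ g ∈ fracEdges p, g ∈ touches ends (exploredSet p ends a₂)
    · -- step: pin a fractional boundary edge `g`
      obtain ⟨g, hg, hgt⟩ := hb
      have hpos : 0 < n := by
        rw [← hn]
        exact Finset.card_pos.mpr ⟨g, hg⟩
      have hc1 : (fracEdges (Function.update p g (1 : R))).card = n - 1 := by
        rw [card_fracEdges_update p hg (Or.inr rfl), hn]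
      have hc0 : (fracEdges (Function.update p g (0 : R))).card = n - 1 := by
        rw [card_fracEdges_update p hg (Or.inl rfl), hn]
      have h1 : 0 ≤ cdSlack (Function.update p g 1) ends a₁ a₂ a₃ o 𝓔 :=
        ih (n - 1) (Nat.sub_lt hpos Nat.one_pos) (Function.update p g 1)
          (hp.update g zero_le_one le_rfl) hc1
      have h2 : 0 ≤ cdSlack (Function.update p g 0) ends a₁ a₂ a₃ o 𝓔 :=
        ih (n - 1) (Nat.sub_lt hpos Nat.one_pos) (Function.update p g 0)
          (hp.update g le_rfl zero_le_one) hc0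
      exact (le_min h1 h2).trans (hqc p hp g hg hgt)
    · -- base: no fractional edge touches the explored set
      have hpin : ∀ g ∈ touches ends (exploredSet p ends a₂), p g = 0 ∨ p g = 1 := by
        intro g hgt
        by_contra hcon
        exact hb ⟨g, by simpa [fracEdges] using hcon, hgt⟩
      have hcl := cdCleared_nonneg_of_boundary_pinned p hp ends a₁ a₂ a₃ o h𝓔 hpin
      unfold cdSlack
      exact div_nonneg hcl (mul_nonneg (pow_nonneg (prob_nonneg hp _) 2) (prob_nonneg hp _))

/-- **THE REDUCTION, boundary form, cleared**: quasi-concavity along the exploration of `C₂` implies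
row 2′CD in cleared form for every admissible weight vector. -/
theorem cdCleared_nonneg_of_quasiConcaveBoundary (ends : E → Sym2 V) (a₁ a₂ a₃ o : V)
    {𝓔 : Set (Set V)} (h𝓔 : IsUpperSet 𝓔)
    (hqc : QuasiConcaveCDBoundary (R := R) ends a₁ a₂ a₃ o 𝓔) (p : E → R) (hp : IsProbVec p) :
    0 ≤ cdCleared p ends a₁ a₂ a₃ o 𝓔 := by
  have h := cdSlack_nonneg_of_quasiConcaveBoundary ends a₁ a₂ a₃ o h𝓔 hqc p hp
  unfold cdSlack at h
  set Q := (connEvent ends a₁ a₂)ᶜ with hQ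
  set Nv := (connEvent ends a₁ a₃)ᶜ ∩ (connEvent ends a₂ a₃)ᶜ with hN
  set den := prob p Q ^ 2 * prob p (Q ∩ Nv) with hden
  have hden0 : 0 ≤ den := mul_nonneg (pow_nonneg (prob_nonneg hp _) 2) (prob_nonneg hp _)
  rcases hden0.lt_or_eq with hpos | hzero
  · have := mul_nonneg h hpos.le
    rwa [div_mul_cancel₀ _ hpos.ne'] at this
  · have hQN : prob p (Q ∩ Nv) = 0 ∨ prob p Q = 0 := by
      rcases mul_eq_zero.mp hzero.symm with h' | h'
      · exact Or.inr (pow_eq_zero_iff (n := 2) (by norm_num) |>.mp h')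
      · exact Or.inl h'
    unfold cdCleared
    simp only
    have hmono : ∀ A : Set (Config E), A ⊆ Q ∩ Nv → prob p A = 0 := by
      intro A hA
      rcases hQN with h' | h'
      · exact le_antisymm ((prob_mono hp hA).trans h'.le) (prob_nonneg hp A)
      · exact le_antisymm ((prob_mono hp (hA.trans Set.inter_subset_left)).trans h'.le)
          (prob_nonneg hp A)
    rw [hmono (Q ∩ Nv ∩ (connEvent ends a₁ o ∪ connEvent ends a₂ o)) Set.inter_subset_left,
      hmono (Q ∩ Nv) le_rfl]
    simp

end Boundary

end CDQC

end Summit.Ventures.PercRepro2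

/-!
## Erratum (mine-a g32, 2026-08-28T15:0xZ; MINE-A.md §87.12)

The hypothesis `QuasiConcaveCDBoundary` above — the Q-world boundary form: pinning a fractional edge
that touches the explored set of `a₂` cannot push the slack below both outcomes — is FALSE.  Exact
counterexample (six vertices, 2,048 configurations, rational arithmetic): edges
`(0,2),(0,3),(0,4),(1,2),(1,3),(1,4),(2,3),(2,4),(3,4),(1,5),(0,5)` with weights
`13/49, 43/44, 42/43, 15/44, 1/37, 1/64, 33/35, 2/61, 11/12, 20/21, 63/64`, `a₁ = 4, a₂ = 1, a₃ = 3,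
o = 2`, `𝓔 = {S | {0, 2, 4} ⊆ S}`, no edge pinned (so `exploredSet = {a₂}`), `g = (1,5)`:
`cdSlack p = 0.0191868…` while `cdSlack (p[g↦1]) = 0.0192838…` and `cdSlack (p[g↦0]) = 0.0192837…`
(the smaller child exceeds the parent by `9.69·10⁻⁵`).  It was found by an adversarial search
(Nelder–Mead over continuous weights, exact re-verification; kit j309480): the Q-world slack along
the edge `a₂–x` of the five-vertex instance without vertex 5 has an interior local minimum
(`Φ(15/16) < min(Φ(0), Φ(63/64))`), and subdividing that edge by an unmarked vertex (a path `a₂–y–x`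
with weights `t, s` is the edge at weight `t·s` for `y`-independent up-sets) turns it into a failure
of the one-edge statement at `a₂–y`.  The reduction theorems above are correct as stated (they are
implications).  The D-world form of the same instance satisfies the inequality (margin `8.0·10⁻⁵`),
and the D-world boundary form — the x-step statement of MINE-A.md §86.13, with the o-attached class
as its base — is the surviving candidate (adversarial search: 0 failures in 200 instance-edges;
random censuses 122,210 + 945,126 + 25,865 steps, 0 failures).
-/

/-!
## Erratum 2 (mine-a g32, 2026-08-28T15:4xZ; MINE-A.md §87.13)

The last sentence of the erratum above is withdrawn: the D-WORLD boundary form (the x-step of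
MINE-A.md §86.13 — quasi-concavity of the D-world slack `cdCleared_D / (P(D)²·P(D ∩ N))`,
`D = Q ∩ {a₃ ∉ C₂}`, in the weight of a fractional edge from the explored set of `a₂` to an
unmarked vertex) is FALSE as well.  Exact counterexample (six vertices, 128 configurations): edges
`(0,1),(0,3),(0,4),(1,2),(2,4),(2,5),(0,5)` with weights
`122465/191427, 797963/857819, 220007/230727, 493118/808983, 0, 13/15, 15/16`, `a₁ = 4, a₂ = 2,
a₃ = 3, o = 1`, `𝓔 = {S | {0, 1, 4} ⊆ S}`, nothing pinned, `g = (2,5)`: the parent's D-world slack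
`0.1347121…` is below both children's (`0.1348249…` each; gap `−1.13·10⁻⁴`); two more in
§87.13.  Found like the Q-world one: an interior local minimum of the D-world profile along
`a₂–x` of the five-vertex instance without vertex 5 (`Φ_D(13/16) < Φ_D(0) = Φ_D(15/16)`), then the
subdivision of that edge by an unmarked vertex.  So the «parent ≥ min(children)» induction along
the exploration of `C₂` is closed in both worlds; the reduction theorems of this file remain
correct as implications, and row 2′CD itself (`0 ≤ cdSlack p`) is untouched by these witnesses.
-/
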